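import Summits.AtomisticToContinuum.FouriersLaw.Theorems.OddSectorIrreversibilityOddDensityIsCorrectorDensity
import Summits.AtomisticToContinuum.FouriersLaw.Theorems.OddSectorIrreversibilityOddDensityIsCorrectorResolventL2

/-!
# `OddDensityIsCorrector`, part 8: detailed balance of the equilibrium resolvent, `R_λ* = Θ R_λ Θ`

Helper file for support item `stmt-AtomisticToContinuum-9146`
(`OddSectorIrreversibility.OddDensityIsCorrector`).

GENERALISED DETAILED BALANCE for the equilibrium transition kernels of the pinned anharmonic chain,
at the level of the resolvent `R_λ = ∫₀^∞ e^{-λt} P_t dt` (`λ > 0`) acting on nice observables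
(continuous, `|·| ≤ C e^{ϑH}`, `0 < ϑ`, `2ϑ < 1/T`), in `L²(μ_T)`:

* `pinnedChain_resolvent_adjoint_test` — for a test function `G` and nice `B`,
  `∫ (λG - (L(G∘Θ))∘Θ) · R_λ B dμ_T = ∫ G B dμ_T` (i.e. `R_λ* (λ - L†) G = G`): true for
  `B = λF - LF` by Dynkin (`R_λ(λF - LF) = F`) and `L† = ΘLΘ` on test functions
  (`pinnedChain_integral_generator_mul_gibbsMeasure_eq_reversal`); extended to all nice `B` by the
  DENSITY of `(λ - L)C_c^∞` (`exists_testFunction_resolvent_approx`) and the `L²`-bound of `R_λ`;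
* `pinnedChain_resolvent_detailed_balance` — **`∫ A · R_λ B dμ_T = ∫ R_λ(A∘Θ) · B∘Θ dμ_T`** for nice
  `A, B`: for `A ∈ Θ(λ - L)C_c^∞` by the previous item and `Θ`-invariance of `μ_T`, then by density.

Nothing here closes an item.
-/

noncomputable section

open MeasureTheory ProbabilityTheory Filter Topology Set Function
open scoped ContDiff NNReal ENNReal
open Literature.MathematicalPhysics.KineticTheory.HeatConduction
open Summit.AtomisticToContinuum.FouriersLaw.Theorems.SubdiffusiveBondHeat

namespace Summit.AtomisticToContinuum.FouriersLaw.Theorems.OddSectorIrreversibility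

variable {N : ℕ}

/-! ### Generalities -/

/-- `∫ g∘Θ dμ_T = ∫ g dμ_T`: the Gibbs measure is invariant under momentum reversal. [folklore] -/
theorem integral_comp_reversal_gibbsMeasure (P : OscillatorChain) (N : ℕ) (T : ℝ) (g : PhaseSpace N → ℝ) :
    ∫ x, g (x.1, -x.2) ∂(P.gibbsMeasure N T) = ∫ x, g x ∂(P.gibbsMeasure N T) := by
  rw [P.integral_gibbsMeasure, P.integral_gibbsMeasure]
  congr 1
  have h := integral_comp_momentumReversal N (fun x => g x * P.gibbsDensity N T x)
  simp only [OscillatorChain.gibbsDensity, OscillatorChain.hamiltonian_neg_momentum] at h ⊢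
  exact h

/-- Momentum reversal preserves the Gibbs measure (`H` is even in the momenta). [folklore] -/
theorem measurePreserving_reversal_gibbsMeasure (P : OscillatorChain) (N : ℕ) (T : ℝ) :
    MeasurePreserving (momentumReversal N) (P.gibbsMeasure N T) (P.gibbsMeasure N T) := by
  refine ⟨(momentumReversal N).measurable, Measure.ext fun s hs => ?_⟩
  rw [Measure.map_apply (momentumReversal N).measurable hs, OscillatorChain.gibbsMeasure, Measure.tilted,
    withDensity_apply _ ((momentumReversal N).measurable hs), withDensity_apply _ hs]
  have key := (measurePreserving_momentumReversal N).setLIntegral_comp_preimage_emb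
    (momentumReversal N).measurableEmbedding
    (fun x => ENNReal.ofReal (Real.exp (-P.hamiltonian N x / T) / ∫ x, Real.exp (-P.hamiltonian N x / T))) s
  simpa only [momentumReversal_apply, OscillatorChain.hamiltonian_neg_momentum] using key

/-- A bounded function is dominated by `B e^{ϑH}` (`H ≥ 0`, `ϑ ≥ 0`). [folklore] -/
theorem abs_le_exp_bound_of_bounded {ω₂ lam β : ℝ} (hω : 0 ≤ ω₂) (hl : 0 ≤ lam) (hβ : 0 ≤ β) (γ : ℝ)
    {ϑ : ℝ} (hϑ : 0 ≤ ϑ) {f : PhaseSpace N → ℝ} {B : ℝ} (hB : ∀ y, ‖f y‖ ≤ B) (y : PhaseSpace N) :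
    |f y| ≤ B * Real.exp (ϑ * (pinnedChain ω₂ lam β γ).hamiltonian N y) :=
  ((Real.norm_eq_abs _).symm.le.trans (hB y)).trans
    (le_mul_of_one_le_right ((norm_nonneg _).trans (hB y))
      (Real.one_le_exp (mul_nonneg hϑ (pinnedChain_hamiltonian_nonneg hω hl hβ γ N y))))

/-- If `|D| ≤ c ε` for every `ε > 0` (`c` fixed), then `D = 0`. [folklore] -/
theorem eq_zero_of_abs_le_mul_eps {D c : ℝ} (h : ∀ ε : ℝ, 0 < ε → |D| ≤ c * ε) : D = 0 := by
  by_contra hD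
  have hDpos : 0 < |D| := abs_pos.2 hD
  rcases le_or_gt c 0 with hc | hc
  · have := h 1 one_pos; nlinarith
  · have := h (|D| / (2 * c)) (by positivity)
    have e : c * (|D| / (2 * c)) = |D| / 2 := by field_simp
    rw [e] at this
    linarith

/-- `f g ∈ L¹` when `f², g² ∈ L¹` (`|fg| ≤ f² + g²`). [folklore] -/
theorem integrable_mul_of_integrable_sq {μ : Measure (PhaseSpace N)} {f g : PhaseSpace N → ℝ}
    (hf : AEStronglyMeasurable f μ) (hg : AEStronglyMeasurable g μ) (hf2 : Integrable (fun y => f y ^ 2) μ)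
    (hg2 : Integrable (fun y => g y ^ 2) μ) : Integrable (fun y => f y * g y) μ := by
  refine (hf2.add hg2).mono' (hf.mul hg) (Eventually.of_forall fun y => ?_)
  rw [Real.norm_eq_abs, abs_mul, Pi.add_apply]
  nlinarith [sq_nonneg (|f y| - |g y|), sq_abs (f y), sq_abs (g y), abs_nonneg (f y), abs_nonneg (g y)]

/-- `|a - b| ≤ |a| + |b|`. [folklore] -/
theorem abs_sub_le_abs_add_abs (a b : ℝ) : |a - b| ≤ |a| + |b| := by
  simpa only [Real.norm_eq_abs] using norm_sub_le a b

/-- The square of a bounded continuous function is integrable for a finite measure. [folklore] -/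
theorem integrable_sq_of_bounded {μ : Measure (PhaseSpace N)} [IsFiniteMeasure μ] {f : PhaseSpace N → ℝ}
    (hf : Continuous f) {B : ℝ} (hB : ∀ y, ‖f y‖ ≤ B) : Integrable (fun y => f y ^ 2) μ := by
  refine (integrable_const (B ^ 2)).mono' (hf.pow 2).aestronglyMeasurable (Eventually.of_forall fun z => ?_)
  rw [Real.norm_eq_abs, abs_pow, ← Real.norm_eq_abs]
  exact pow_le_pow_left₀ (norm_nonneg _) (hB z) 2

section Pinned

variable {ω₂ lam β γ : ℝ} (hω : 0 < ω₂) (hl : 0 ≤ lam) (hβ : 0 < β) (hγ : 0 < γ) (hN : 2 ≤ N)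
  {T : ℝ} (hT : 0 < T)
include hω hl hβ hγ hN hT

/-- **`R_λ* (λ - L†) G = G` on nice observables.** For a test function `G`, nice `B` and `λ > 0`:
`∫ (λG - (L(G∘Θ))∘Θ) · R_λ B dμ_T = ∫ G B dμ_T`. [cite: KunduDharNarayan2009, eq. (reln2)] -/
theorem pinnedChain_resolvent_adjoint_test {ϑ : ℝ} (hϑ0 : 0 < ϑ) (h2ϑ : 2 * ϑ < 1 / T)
    {G : PhaseSpace N → ℝ} (hG : ContDiff ℝ ∞ G) (hGc : HasCompactSupport G)
    {B : PhaseSpace N → ℝ} (hB : Continuous B) {CB : ℝ} (hCB : 0 ≤ CB)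
    (hBb : ∀ y, |B y| ≤ CB * Real.exp (ϑ * (pinnedChain ω₂ lam β γ).hamiltonian N y))
    {lam' : ℝ} (hlam : 0 < lam') :
    ∫ z, (lam' * G z - (pinnedChain ω₂ lam β γ).generator N T T (fun y : PhaseSpace N => G (y.1, -y.2)) (z.1, -z.2)) *
        (∫ t in Ioi (0 : ℝ), Real.exp (-(lam' * t)) *
          ∫ y, B y ∂((pinnedChain ω₂ lam β γ).transitionKernel N T T t.toNNReal z))
        ∂((pinnedChain ω₂ lam β γ).gibbsMeasure N T) =
      ∫ z, G z * B z ∂((pinnedChain ω₂ lam β γ).gibbsMeasure N T) := by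
  set P := pinnedChain ω₂ lam β γ with hP
  set π := P.gibbsMeasure N T with hπ
  have hN0 : 0 < N := by omega
  have hϑ1 : ϑ < 1 / T := by linarith
  haveI : IsProbabilityMeasure π := pinnedChain_isProbabilityMeasure_gibbsMeasure hω hl hβ.le γ N hT
  have hU1 : ContDiff ℝ 1 P.U := pinnedChain_contDiff_U ω₂ lam β γ
  have hV1 : ContDiff ℝ 1 P.V := pinnedChain_contDiff_V ω₂ lam β γ
  -- the resolvent as a function
  set R : (PhaseSpace N → ℝ) → PhaseSpace N → ℝ := fun f z => ∫ t in Ioi (0 : ℝ), Real.exp (-(lam' * t)) *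
    ∫ y, f y ∂(P.transitionKernel N T T t.toNNReal z) with hR
  -- the test function `A = λG - G†` (bounded, continuous, compactly supported)
  have hΘc : Continuous (fun y : PhaseSpace N => ((y.1, -y.2) : PhaseSpace N)) := continuous_fst.prodMk continuous_snd.neg
  have hΘs : ContDiff ℝ ∞ (fun y : PhaseSpace N => ((y.1, -y.2) : PhaseSpace N)) := contDiff_fst.prodMk contDiff_snd.neg
  set Θh : PhaseSpace N ≃ₜ PhaseSpace N := (Homeomorph.refl (Fin N → ℝ)).prodCongr (Homeomorph.neg (Fin N → ℝ))
    with hΘh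
  have hGΘ : ContDiff ℝ ∞ (fun y : PhaseSpace N => G (y.1, -y.2)) := hG.comp hΘs
  have hGΘ2 : ContDiff ℝ 2 (fun y : PhaseSpace N => G (y.1, -y.2)) := hGΘ.of_le (by norm_cast)
  have hGΘc : HasCompactSupport (fun y : PhaseSpace N => G (y.1, -y.2)) := hGc.comp_homeomorph Θh
  have hLGc : Continuous (P.generator N T T (fun y : PhaseSpace N => G (y.1, -y.2))) :=
    P.continuous_generator hU1 hV1 N T T hGΘ2
  have hLGs : HasCompactSupport (P.generator N T T (fun y : PhaseSpace N => G (y.1, -y.2))) :=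
    P.hasCompactSupport_generator N T T hGΘ2 hGΘc
  set A : PhaseSpace N → ℝ := fun z => lam' * G z - P.generator N T T (fun y : PhaseSpace N => G (y.1, -y.2)) (z.1, -z.2)
    with hA
  have hAc : Continuous A := (continuous_const.mul hG.continuous).sub (hLGc.comp hΘc)
  have hAs : HasCompactSupport A := (hGc.mul_left).sub (hLGs.comp_homeomorph Θh)
  obtain ⟨BA, hBA⟩ := hAc.bounded_above_of_compact_support hAs
  obtain ⟨BG, hBG⟩ := hG.continuous.bounded_above_of_compact_support hGc
  have hA2 : Integrable (fun z => A z ^ 2) π := integrable_sq_of_bounded hAc hBA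
  have hG2 : Integrable (fun z => G z ^ 2) π := integrable_sq_of_bounded hG.continuous hBG
  -- Step (a): the identity for `B' = λF - LF`, `F` a test function
  have stepA : ∀ F : PhaseSpace N → ℝ, ContDiff ℝ ∞ F → HasCompactSupport F →
      ∫ z, A z * R (fun y => lam' * F y - P.generator N T T F y) z ∂π =
        ∫ z, G z * (lam' * F z - P.generator N T T F z) ∂π := by
    intro F hF hFc
    have hF2 : ContDiff ℝ 2 F := hF.of_le (by norm_cast)
    have hRF : ∀ z, R (fun y => lam' * F y - P.generator N T T F y) z = F z :=
      fun z => pinnedChain_resolvent_sub_generator hω hl hβ hγ hN0 hT hF hFc hlam z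
    simp_rw [hRF]
    have hLFc : Continuous (P.generator N T T F) := P.continuous_generator hU1 hV1 N T T hF2
    have i1 : Integrable (fun z => lam' * (G z * F z)) π :=
      ((hG.continuous.mul hF.continuous).integrable_of_hasCompactSupport hFc.mul_left).const_mul lam'
    have i2 : Integrable (fun z => F z * P.generator N T T (fun y : PhaseSpace N => G (y.1, -y.2)) (z.1, -z.2)) π :=
      (hF.continuous.mul (hLGc.comp hΘc)).integrable_of_hasCompactSupport hFc.mul_right
    have i3 : Integrable (fun z => P.generator N T T F z * G z) π :=
      (hLFc.mul hG.continuous).integrable_of_hasCompactSupport hGc.mul_left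
    have e1 : ∫ z, A z * F z ∂π = (∫ z, lam' * (G z * F z) ∂π) -
        ∫ z, F z * P.generator N T T (fun y : PhaseSpace N => G (y.1, -y.2)) (z.1, -z.2) ∂π := by
      rw [← integral_sub i1 i2]
      exact integral_congr_ae (Eventually.of_forall fun z => by simp only [hA]; ring)
    have e2 : ∫ z, G z * (lam' * F z - P.generator N T T F z) ∂π = (∫ z, lam' * (G z * F z) ∂π) -
        ∫ z, P.generator N T T F z * G z ∂π := by
      rw [← integral_sub i1 i3]
      exact integral_congr_ae (Eventually.of_forall fun z => by ring)
    rw [e1, e2, pinnedChain_integral_generator_mul_gibbsMeasure_eq_reversal ω₂ lam β γ N hT.ne' hF2 hFc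
      (hG.of_le (by norm_cast) : ContDiff ℝ 2 G)]
  -- Step (b): density of `(λ - L)C_c^∞` in `L²(μ_T)`
  obtain ⟨K, c, -, hc, hb⟩ := pinnedChain_harris_bound hω hl hβ hγ hN0 hT hϑ0 hϑ1
  have hB2 : Integrable (fun z => B z ^ 2) π := (pinnedChain_integral_sq_act_le hω hl hβ hγ hN0 hT hϑ0 h2ϑ hB hBb 0).1
  have hBm : MemLp B 2 π := (memLp_two_iff_integrable_sq hB.aestronglyMeasurable).2 hB2
  have hRB := pinnedChain_integral_sq_resolvent_le hω hl hβ hγ hN0 hT hϑ0 h2ϑ hB hCB hBb hlam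
  have hRBm : AEStronglyMeasurable (R B) π :=
    (pinnedChain_stronglyMeasurable_resolvent hω hl hβ.le hγ.le T T hB.measurable lam').aestronglyMeasurable
  set c₀ : ℝ := ((∫ z, A z ^ 2 ∂π) + lam'⁻¹ ^ 2 + (∫ z, G z ^ 2 ∂π) + 1) / 2 with hc₀
  refine sub_eq_zero.1 (eq_zero_of_abs_le_mul_eps (c := c₀) fun ε hε => ?_)
  obtain ⟨F, hF, hFc, happ⟩ := exists_testFunction_resolvent_approx hω hl hβ.le hγ hN hT hlam hBm (ε := ε ^ 2)
    (by positivity)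
  have hF2 : ContDiff ℝ 2 F := hF.of_le (by norm_cast)
  set B' : PhaseSpace N → ℝ := fun y => lam' * F y - P.generator N T T F y with hB'
  have hB'c : Continuous B' := (continuous_const.mul hF.continuous).sub (P.continuous_generator hU1 hV1 N T T hF2)
  have hB's : HasCompactSupport B' := (hFc.mul_left).sub (P.hasCompactSupport_generator N T T hF2 hFc)
  obtain ⟨BB, hBB⟩ := hB'c.bounded_above_of_compact_support hB's
  have hBB0 : 0 ≤ BB := (norm_nonneg _).trans (hBB 0)
  have hB'b : ∀ y, |B' y| ≤ BB * Real.exp (ϑ * P.hamiltonian N y) :=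
    abs_le_exp_bound_of_bounded hω.le hl hβ.le γ hϑ0.le hBB
  have hB'2 : Integrable (fun z => B' z ^ 2) π := integrable_sq_of_bounded hB'c hBB
  -- `B - B'` is nice; `R(B - B') = RB - RB'`; its `L²` norm is `≤ ε/λ`
  have hDc : Continuous fun y => B y - B' y := hB.sub hB'c
  have hDb : ∀ y, |B y - B' y| ≤ (CB + BB) * Real.exp (ϑ * P.hamiltonian N y) := fun y => by
    have := abs_sub_le_abs_add_abs (B y) (B' y); have h1 := hBb y; have h2 := hB'b y; linarith
  have hRD := pinnedChain_integral_sq_resolvent_le hω hl hβ hγ hN0 hT hϑ0 h2ϑ hDc (by positivity) hDb hlam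
  have hRB' := pinnedChain_integral_sq_resolvent_le hω hl hβ hγ hN0 hT hϑ0 h2ϑ hB'c hBB0 hB'b hlam
  have hRsub : ∀ z, R (fun y => B y - B' y) z = R B z - R B' z :=
    fun z => pinnedChain_resolvent_sub hω hl hβ hγ hN0 hT hϑ0 hϑ1 hB hB'c hCB hBB0 hBb hB'b hlam z
  have hRB'm : AEStronglyMeasurable (R B') π :=
    (pinnedChain_stronglyMeasurable_resolvent hω hl hβ.le hγ.le T T hB'c.measurable lam').aestronglyMeasurable
  have hRDm : AEStronglyMeasurable (R fun y => B y - B' y) π :=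
    (pinnedChain_stronglyMeasurable_resolvent hω hl hβ.le hγ.le T T hDc.measurable lam').aestronglyMeasurable
  -- the difference `D = ∫ A·R(B - B') - ∫ G (B - B')`
  have iARB : Integrable (fun z => A z * R B z) π :=
    integrable_mul_of_integrable_sq hAc.aestronglyMeasurable hRBm hA2 hRB.1
  have iARB' : Integrable (fun z => A z * R B' z) π :=
    integrable_mul_of_integrable_sq hAc.aestronglyMeasurable hRB'm hA2 hRB'.1
  have iGB : Integrable (fun z => G z * B z) π :=
    integrable_mul_of_integrable_sq hG.continuous.aestronglyMeasurable hB.aestronglyMeasurable hG2 hB2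
  have iGB' : Integrable (fun z => G z * B' z) π :=
    integrable_mul_of_integrable_sq hG.continuous.aestronglyMeasurable hB'c.aestronglyMeasurable hG2 hB'2
  have hD : (∫ z, A z * R B z ∂π) - ∫ z, G z * B z ∂π =
      (∫ z, A z * R (fun y => B y - B' y) z ∂π) - ∫ z, G z * (B z - B' z) ∂π := by
    have hA' := stepA F hF hFc
    have e1 : ∫ z, A z * R (fun y => B y - B' y) z ∂π = (∫ z, A z * R B z ∂π) - ∫ z, A z * R B' z ∂π := by
      rw [← integral_sub iARB iARB']
      exact integral_congr_ae (Eventually.of_forall fun z => by dsimp only; rw [hRsub]; ring)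
    have e2 : ∫ z, G z * (B z - B' z) ∂π = (∫ z, G z * B z ∂π) - ∫ z, G z * B' z ∂π := by
      rw [← integral_sub iGB iGB']
      exact integral_congr_ae (Eventually.of_forall fun z => by ring)
    rw [e1, e2, hA']
    ring
  rw [hD]
  -- bounds by weighted AM–GM with weight `ε`
  have hsqD : ∫ z, (B z - B' z) ^ 2 ∂π ≤ ε ^ 2 := happ
  have h1 := abs_integral_mul_le_weighted (μ := π) hA2 hRD.1 hε
  have hBB'2 : Integrable (fun z => (B z - B' z) ^ 2) π :=
    ((hB2.add hB'2).const_mul 2).mono' ((hB.sub hB'c).pow 2).aestronglyMeasurable (Eventually.of_forall fun z => by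
      rw [Real.norm_eq_abs, abs_of_nonneg (sq_nonneg _), Pi.add_apply]; nlinarith [sq_nonneg (B z + B' z)])
  have h2 := abs_integral_mul_le_weighted (μ := π) hG2 hBB'2 hε
  have hRD2 : ∫ z, (R (fun y => B y - B' y) z) ^ 2 ∂π ≤ lam'⁻¹ ^ 2 * ε ^ 2 :=
    hRD.2.trans (mul_le_mul_of_nonneg_left hsqD (sq_nonneg _))
  have hI0 : 0 ≤ ∫ z, A z ^ 2 ∂π := integral_nonneg fun z => sq_nonneg _
  have hG0 : 0 ≤ ∫ z, G z ^ 2 ∂π := integral_nonneg fun z => sq_nonneg _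
  calc |(∫ z, A z * R (fun y => B y - B' y) z ∂π) - ∫ z, G z * (B z - B' z) ∂π|
      ≤ |∫ z, A z * R (fun y => B y - B' y) z ∂π| + |∫ z, G z * (B z - B' z) ∂π| := abs_sub_le_abs_add_abs _ _
    _ ≤ (ε * ∫ z, A z ^ 2 ∂π + ε⁻¹ * ∫ z, (R (fun y => B y - B' y) z) ^ 2 ∂π) / 2 +
          (ε * ∫ z, G z ^ 2 ∂π + ε⁻¹ * ∫ z, (B z - B' z) ^ 2 ∂π) / 2 := add_le_add h1 h2
    _ ≤ (ε * ∫ z, A z ^ 2 ∂π + ε⁻¹ * (lam'⁻¹ ^ 2 * ε ^ 2)) / 2 + (ε * ∫ z, G z ^ 2 ∂π + ε⁻¹ * ε ^ 2) / 2 := by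
          gcongr
    _ = c₀ * ε := by simp only [hc₀]; field_simp; ring

/-- **Detailed balance of the equilibrium resolvent, `R_λ* = Θ R_λ Θ`.** For nice `A, B` and `λ > 0`:
`∫ A · R_λ B dμ_T = ∫ R_λ(A∘Θ) · (B∘Θ) dμ_T`. For `A = ((λ - L)F)∘Θ` (`F` a test function) this is
the previous identity read through the `Θ`-invariance of `μ_T` (`R_λ(A∘Θ) = F`); the general case
follows by the density of `Θ(λ - L)C_c^∞` in `L²(μ_T)` and the `L²`-bound of `R_λ`.
[cite: KunduDharNarayan2009, eq. (reln2)] [cite: MaesNetocny2010, §3] -/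
theorem pinnedChain_resolvent_detailed_balance {ϑ : ℝ} (hϑ0 : 0 < ϑ) (h2ϑ : 2 * ϑ < 1 / T)
    {A B : PhaseSpace N → ℝ} (hA : Continuous A) (hB : Continuous B) {CA CB : ℝ} (hCA : 0 ≤ CA) (hCB : 0 ≤ CB)
    (hAb : ∀ y, |A y| ≤ CA * Real.exp (ϑ * (pinnedChain ω₂ lam β γ).hamiltonian N y))
    (hBb : ∀ y, |B y| ≤ CB * Real.exp (ϑ * (pinnedChain ω₂ lam β γ).hamiltonian N y))
    {lam' : ℝ} (hlam : 0 < lam') :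
    ∫ z, A z * (∫ t in Ioi (0 : ℝ), Real.exp (-(lam' * t)) *
          ∫ y, B y ∂((pinnedChain ω₂ lam β γ).transitionKernel N T T t.toNNReal z))
        ∂((pinnedChain ω₂ lam β γ).gibbsMeasure N T) =
      ∫ z, (∫ t in Ioi (0 : ℝ), Real.exp (-(lam' * t)) *
          ∫ y, A (y.1, -y.2) ∂((pinnedChain ω₂ lam β γ).transitionKernel N T T t.toNNReal z)) * B (z.1, -z.2)
        ∂((pinnedChain ω₂ lam β γ).gibbsMeasure N T) := by
  set P := pinnedChain ω₂ lam β γ with hP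
  set π := P.gibbsMeasure N T with hπ
  have hN0 : 0 < N := by omega
  have hϑ1 : ϑ < 1 / T := by linarith
  haveI : IsProbabilityMeasure π := pinnedChain_isProbabilityMeasure_gibbsMeasure hω hl hβ.le γ N hT
  have hU1 : ContDiff ℝ 1 P.U := pinnedChain_contDiff_U ω₂ lam β γ
  have hV1 : ContDiff ℝ 1 P.V := pinnedChain_contDiff_V ω₂ lam β γ
  set R : (PhaseSpace N → ℝ) → PhaseSpace N → ℝ := fun f z => ∫ t in Ioi (0 : ℝ), Real.exp (-(lam' * t)) *
    ∫ y, f y ∂(P.transitionKernel N T T t.toNNReal z) with hR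
  have hΘc : Continuous (fun y : PhaseSpace N => ((y.1, -y.2) : PhaseSpace N)) := continuous_fst.prodMk continuous_snd.neg
  have hΘs : ContDiff ℝ ∞ (fun y : PhaseSpace N => ((y.1, -y.2) : PhaseSpace N)) := contDiff_fst.prodMk contDiff_snd.neg
  set Θh : PhaseSpace N ≃ₜ PhaseSpace N := (Homeomorph.refl (Fin N → ℝ)).prodCongr (Homeomorph.neg (Fin N → ℝ))
    with hΘh
  have hHΘ : ∀ y : PhaseSpace N, P.hamiltonian N (y.1, -y.2) = P.hamiltonian N y :=
    fun y => OscillatorChain.hamiltonian_neg_momentum P N y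
  -- niceness of `A∘Θ`, `B∘Θ`
  have hAΘ : Continuous fun y : PhaseSpace N => A (y.1, -y.2) := hA.comp hΘc
  have hBΘ : Continuous fun y : PhaseSpace N => B (y.1, -y.2) := hB.comp hΘc
  have hAΘb : ∀ y : PhaseSpace N, |A (y.1, -y.2)| ≤ CA * Real.exp (ϑ * P.hamiltonian N y) := fun y => by
    have := hAb (y.1, -y.2); rwa [hHΘ] at this
  have hBΘb : ∀ y : PhaseSpace N, |B (y.1, -y.2)| ≤ CB * Real.exp (ϑ * P.hamiltonian N y) := fun y => by
    have := hBb (y.1, -y.2); rwa [hHΘ] at this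
  obtain ⟨K, c, -, hc, hb⟩ := pinnedChain_harris_bound hω hl hβ hγ hN0 hT hϑ0 hϑ1
  have hB2 : Integrable (fun z => B z ^ 2) π := (pinnedChain_integral_sq_act_le hω hl hβ hγ hN0 hT hϑ0 h2ϑ hB hBb 0).1
  have hBΘ2 : Integrable (fun z : PhaseSpace N => B (z.1, -z.2) ^ 2) π :=
    (pinnedChain_integral_sq_act_le hω hl hβ hγ hN0 hT hϑ0 h2ϑ hBΘ hBΘb 0).1
  have hA2 : Integrable (fun z => A z ^ 2) π := (pinnedChain_integral_sq_act_le hω hl hβ hγ hN0 hT hϑ0 h2ϑ hA hAb 0).1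
  have hAΘm : MemLp (fun y : PhaseSpace N => A (y.1, -y.2)) 2 π :=
    (memLp_two_iff_integrable_sq hAΘ.aestronglyMeasurable).2
      (pinnedChain_integral_sq_act_le hω hl hβ hγ hN0 hT hϑ0 h2ϑ hAΘ hAΘb 0).1
  have hRB := pinnedChain_integral_sq_resolvent_le hω hl hβ hγ hN0 hT hϑ0 h2ϑ hB hCB hBb hlam
  have hRBm : AEStronglyMeasurable (R B) π :=
    (pinnedChain_stronglyMeasurable_resolvent hω hl hβ.le hγ.le T T hB.measurable lam').aestronglyMeasurable
  -- Step (a): `A' = ((λ - L)F)∘Θ` for a test function `F`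
  have stepA : ∀ F : PhaseSpace N → ℝ, ContDiff ℝ ∞ F → HasCompactSupport F →
      ∫ z, (lam' * F (z.1, -z.2) - P.generator N T T F (z.1, -z.2)) * R B z ∂π =
        ∫ z, F z * B (z.1, -z.2) ∂π := by
    intro F hF hFc
    -- `G = F∘Θ` is a test function with `GΘ = F`, so `λG - (L(GΘ))∘Θ = ((λ - L)F)∘Θ`
    have hG : ContDiff ℝ ∞ (fun y : PhaseSpace N => F (y.1, -y.2)) := hF.comp hΘs
    have hGc : HasCompactSupport (fun y : PhaseSpace N => F (y.1, -y.2)) := hFc.comp_homeomorph Θh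
    have hGG : (fun y : PhaseSpace N => (fun w : PhaseSpace N => F (w.1, -w.2)) (y.1, -y.2)) = F := by
      funext y; simp
    have h := pinnedChain_resolvent_adjoint_test hω hl hβ hγ hN hT hϑ0 h2ϑ hG hGc hB hCB hBb hlam
    rw [hGG] at h
    rw [h]
    -- `∫ F(Θz) B(z) = ∫ F(z) B(Θz)` by `Θ`-invariance of `μ_T`
    have := integral_comp_reversal_gibbsMeasure P N T (fun z => F z * B (z.1, -z.2))
    simp only [neg_neg, Prod.mk.eta] at this
    exact this
  -- Step (b): density of `Θ(λ - L)C_c^∞`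
  set c₀ : ℝ := (1 + (∫ z, R B z ^ 2 ∂π) + lam'⁻¹ ^ 2 + ∫ z, B (z.1, -z.2) ^ 2 ∂π) / 2 with hc₀
  refine sub_eq_zero.1 (eq_zero_of_abs_le_mul_eps (c := c₀) fun ε hε => ?_)
  obtain ⟨F, hF, hFc, happ⟩ := exists_testFunction_resolvent_approx hω hl hβ.le hγ hN hT hlam hAΘm (ε := ε ^ 2)
    (by positivity)
  have hF2 : ContDiff ℝ 2 F := hF.of_le (by norm_cast)
  -- `E = λF - LF` (`= A'∘Θ`) and `A' = E∘Θ`, bounded test functions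
  set E : PhaseSpace N → ℝ := fun y => lam' * F y - P.generator N T T F y with hE
  have hEc : Continuous E := (continuous_const.mul hF.continuous).sub (P.continuous_generator hU1 hV1 N T T hF2)
  have hEs : HasCompactSupport E := (hFc.mul_left).sub (P.hasCompactSupport_generator N T T hF2 hFc)
  obtain ⟨BE, hBE⟩ := hEc.bounded_above_of_compact_support hEs
  have hBE0 : 0 ≤ BE := (norm_nonneg _).trans (hBE 0)
  have hEb : ∀ y, |E y| ≤ BE * Real.exp (ϑ * P.hamiltonian N y) := abs_le_exp_bound_of_bounded hω.le hl hβ.le γ hϑ0.le hBE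
  set A' : PhaseSpace N → ℝ := fun z => E (z.1, -z.2) with hA'
  have hA'c : Continuous A' := hEc.comp hΘc
  have hA'b : ∀ y, |A' y| ≤ BE * Real.exp (ϑ * P.hamiltonian N y) := fun y => by
    have := hEb (y.1, -y.2); rwa [hHΘ] at this
  -- `AΘ - E` is nice and `∫ (AΘ - E)² ≤ ε²`; `A - A'` likewise
  have hDc : Continuous fun y : PhaseSpace N => A (y.1, -y.2) - E y := hAΘ.sub hEc
  have hDb : ∀ y : PhaseSpace N, |A (y.1, -y.2) - E y| ≤ (CA + BE) * Real.exp (ϑ * P.hamiltonian N y) := fun y => by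
    have := abs_sub_le_abs_add_abs (A (y.1, -y.2)) (E y); have h1 := hAΘb y; have h2 := hEb y; linarith
  have hRD := pinnedChain_integral_sq_resolvent_le hω hl hβ hγ hN0 hT hϑ0 h2ϑ hDc (by positivity) hDb hlam
  have hRE := pinnedChain_integral_sq_resolvent_le hω hl hβ hγ hN0 hT hϑ0 h2ϑ hEc hBE0 hEb hlam
  have hRAΘ := pinnedChain_integral_sq_resolvent_le hω hl hβ hγ hN0 hT hϑ0 h2ϑ hAΘ hCA hAΘb hlam
  have hRsub : ∀ z, R (fun y : PhaseSpace N => A (y.1, -y.2) - E y) z = R (fun y : PhaseSpace N => A (y.1, -y.2)) z - R E z :=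
    fun z => pinnedChain_resolvent_sub hω hl hβ hγ hN0 hT hϑ0 hϑ1 hAΘ hEc hCA hBE0 hAΘb hEb hlam z
  have hsqD : ∫ z, (A (z.1, -z.2) - E z) ^ 2 ∂π ≤ ε ^ 2 := happ
  have hsqD' : ∫ z, (A z - A' z) ^ 2 ∂π ≤ ε ^ 2 := by
    have := integral_comp_reversal_gibbsMeasure P N T (fun z => (A z - A' z) ^ 2)
    simp only [hA', neg_neg, Prod.mk.eta] at this
    rw [← this]
    exact hsqD
  -- measurability / integrability
  have hREm : AEStronglyMeasurable (R E) π :=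
    (pinnedChain_stronglyMeasurable_resolvent hω hl hβ.le hγ.le T T hEc.measurable lam').aestronglyMeasurable
  have hRAΘm : AEStronglyMeasurable (R fun y : PhaseSpace N => A (y.1, -y.2)) π :=
    (pinnedChain_stronglyMeasurable_resolvent hω hl hβ.le hγ.le T T hAΘ.measurable lam').aestronglyMeasurable
  have hA'2 : Integrable (fun z => A' z ^ 2) π := integrable_sq_of_bounded hA'c (fun y => hBE _)
  have hAA'2 : Integrable (fun z => (A z - A' z) ^ 2) π :=
    ((hA2.add hA'2).const_mul 2).mono' ((hA.sub hA'c).pow 2).aestronglyMeasurable (Eventually.of_forall fun z => by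
      rw [Real.norm_eq_abs, abs_of_nonneg (sq_nonneg _), Pi.add_apply]; nlinarith [sq_nonneg (A z + A' z)])
  have iARB : Integrable (fun z => A z * R B z) π := integrable_mul_of_integrable_sq hA.aestronglyMeasurable hRBm hA2 hRB.1
  have iA'RB : Integrable (fun z => A' z * R B z) π :=
    integrable_mul_of_integrable_sq hA'c.aestronglyMeasurable hRBm hA'2 hRB.1
  have iRAB : Integrable (fun z => R (fun y : PhaseSpace N => A (y.1, -y.2)) z * B (z.1, -z.2)) π :=
    integrable_mul_of_integrable_sq hRAΘm hBΘ.aestronglyMeasurable hRAΘ.1 hBΘ2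
  have iREB : Integrable (fun z => R E z * B (z.1, -z.2)) π :=
    integrable_mul_of_integrable_sq hREm hBΘ.aestronglyMeasurable hRE.1 hBΘ2
  -- `LHS(A') = RHS(A')` by Step (a), with `R(A'∘Θ) = R E = F`... (we only need the integrated form)
  have hA'eq : ∫ z, A' z * R B z ∂π = ∫ z, R E z * B (z.1, -z.2) ∂π := by
    have h1 := stepA F hF hFc
    have hRE' : ∀ z, R E z = F z := fun z => pinnedChain_resolvent_sub_generator hω hl hβ hγ hN0 hT hF hFc hlam z
    simp_rw [hRE']
    simpa only [hA', hE] using h1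
  -- the difference
  have hD : (∫ z, A z * R B z ∂π) - ∫ z, R (fun y : PhaseSpace N => A (y.1, -y.2)) z * B (z.1, -z.2) ∂π =
      (∫ z, (A z - A' z) * R B z ∂π) -
        ∫ z, R (fun y : PhaseSpace N => A (y.1, -y.2) - E y) z * B (z.1, -z.2) ∂π := by
    have e1 : ∫ z, (A z - A' z) * R B z ∂π = (∫ z, A z * R B z ∂π) - ∫ z, A' z * R B z ∂π := by
      rw [← integral_sub iARB iA'RB]
      exact integral_congr_ae (Eventually.of_forall fun z => by ring)
    have e2 : ∫ z, R (fun y : PhaseSpace N => A (y.1, -y.2) - E y) z * B (z.1, -z.2) ∂π =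
        (∫ z, R (fun y : PhaseSpace N => A (y.1, -y.2)) z * B (z.1, -z.2) ∂π) - ∫ z, R E z * B (z.1, -z.2) ∂π := by
      rw [← integral_sub iRAB iREB]
      exact integral_congr_ae (Eventually.of_forall fun z => by dsimp only; rw [hRsub]; ring)
    rw [e1, e2, hA'eq]
    ring
  rw [hD]
  -- bounds by weighted AM–GM with weight `ε⁻¹`
  have hε' : 0 < ε⁻¹ := inv_pos.2 hε
  have h1 := abs_integral_mul_le_weighted (μ := π) hAA'2 hRB.1 hε'
  have h2 := abs_integral_mul_le_weighted (μ := π) hRD.1 hBΘ2 hε'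
  have hRD2 : ∫ z, (R (fun y : PhaseSpace N => A (y.1, -y.2) - E y) z) ^ 2 ∂π ≤ lam'⁻¹ ^ 2 * ε ^ 2 :=
    hRD.2.trans (mul_le_mul_of_nonneg_left hsqD (sq_nonneg _))
  have hI0 : 0 ≤ ∫ z, R B z ^ 2 ∂π := integral_nonneg fun z => sq_nonneg _
  have hB0 : 0 ≤ ∫ z, B (z.1, -z.2) ^ 2 ∂π := integral_nonneg fun z => sq_nonneg _
  rw [inv_inv] at h1 h2
  calc |(∫ z, (A z - A' z) * R B z ∂π) - ∫ z, R (fun y : PhaseSpace N => A (y.1, -y.2) - E y) z * B (z.1, -z.2) ∂π|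
      ≤ |∫ z, (A z - A' z) * R B z ∂π| + |∫ z, R (fun y : PhaseSpace N => A (y.1, -y.2) - E y) z * B (z.1, -z.2) ∂π| :=
        abs_sub_le_abs_add_abs _ _
    _ ≤ (ε⁻¹ * ∫ z, (A z - A' z) ^ 2 ∂π + ε * ∫ z, R B z ^ 2 ∂π) / 2 +
          (ε⁻¹ * ∫ z, (R (fun y : PhaseSpace N => A (y.1, -y.2) - E y) z) ^ 2 ∂π + ε * ∫ z, B (z.1, -z.2) ^ 2 ∂π) / 2 :=
        add_le_add h1 h2
    _ ≤ (ε⁻¹ * ε ^ 2 + ε * ∫ z, R B z ^ 2 ∂π) / 2 + (ε⁻¹ * (lam'⁻¹ ^ 2 * ε ^ 2) + ε * ∫ z, B (z.1, -z.2) ^ 2 ∂π) / 2 := by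
        gcongr
    _ = c₀ * ε := by simp only [hc₀]; field_simp; ring

end Pinned

end Summit.AtomisticToContinuum.FouriersLaw.Theorems.OddSectorIrreversibility

end
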